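import Mathlib.LinearAlgebra.Lagrange
import Mathlib.Data.Matrix.Mul
import Mathlib.Algebra.BigOperators.Fin
import Mathlib.Algebra.Polynomial.BigOperators
import Mathlib.LinearAlgebra.Matrix.Rank
import Literature.Computability.AlgebraicComplexity.FSV18SuccinctGenerators
import Literature.Algebra.Polynomial.JacobianCriterion
import HarnessLib

/-!
# Forbes–Shpilka–Volk 2018, §6–§8: read-once oblivious ABPs (the width-`w²` roABP-succinct
# Forbes–Shpilka generator, Lemma 55 – Cor. 60), the Jacobian statements of §6 (Def. 50 – Lemma 52),
# and the open problems of §8 (val-lit t21, row FSV2018-B; source `paper:arxiv-1701.05328` chunks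
# p0020, p0022–p0025; ToC 14(18) pp. 26, 31–34; bib `ForbesShpilkaVolk2018`)

Typed literature; `VP ≠ VNP` is NOT proved and nothing here is progress on it. Forbes–Shpilka–Volk,
*Succinct hitting sets and barriers to proving lower bounds for algebraic circuits*, Theory of
Computing 14(18) (2018) 1–45 = STOC 2017 = arXiv:1701.05328 (v2, the held TeX-derived chunks;
macro-dropped tokens cross-read against the arXiv e-print `main.tex` and the ToC PDF text
`HOME/lit/pdftxt/FSV2018-ToC`). Decl names use the arXiv sequential numbering (cell ruling); the
ToC numbering is given in every docstring (§6 = Def. 6.1 – Cor. 6.5, §7 = Lemma 7.1 – Cor. 7.6).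

## What is here

* **roABP tooling over the cell's class predicate** `IsROABP F w d π f` (FSV §5.3's printed
  `(1,1)`-entry matrix form, `FSV18SuccinctGenerators.lean`, val-lit t18): the explicit source/sink
  evaluation `roABPEval` (`uᵀ ∏ M_i(x_{e i}) v` with univariate-polynomial matrices), its path
  expansion `dotProduct_listProd_mulVec` / `roABPEval_eq_sum` ("the sum over all `s → t` paths"),
  the renaming lemma `IsROABP.rename` (§7.1's "apply a permutation"), and the bridge
  `isROABP_roABPEval_single` (fold the sink weights into the last layer, as in Claim 58's proof).
* **§7 as printed and PROVED where FSV prove it:** the binary order `binaryOrder n` of the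
  `N = 2ⁿ` coordinates and the EXPLICIT monomial-compatible orderings `monomialCompatibleOrder σ`
  of §7.1 (the binary order after permuting `x_1, …, x_n` by `σ`; `permMonomials`,
  `monomialCompatibleOrder_eq_trans`; the cell's abstract predicate `IsMonomialCompatible π` —
  lexicographic in a priority order — is used by its Thm. 10 fact `FSV2018_thm10`; the bridge
  "`IsMonomialCompatible π ↔ π = monomialCompatibleOrder σ'` for some `σ'`" is NOT proved here);
  the Forbes–Shpilka generator `fsGenCoord` (Lemma 55, eq. (7.1)) and its succinct form `fsPoly`
  (Def. 56); **Claim 57** `coeff_fsPoly` / `coeffVector_fsPoly` and **Claim 58** `isROABP_fsPoly`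
  (transition matrices `fsMatrix`) PROVED, hence `isSuccinctGenerator_fsGenCoord` (the
  succinctness half of Cor. 59, unconditional); **Lemma 55** itself (the hitting property, proved in
  Forbes–Shpilka 2013 by rank concentration, only cited by FSV) is the NAMED FACT
  `ForbesShpilkaVolk2018_lemma55`; **Cor. 59** `ForbesShpilkaVolk2018_cor59` and **Cor. 60**
  `ForbesShpilkaVolk2018_cor60` (§7.1, over an infinite field, for the explicit orders
  `monomialCompatibleOrder σ`) are PROVED from it; Claims 57–58 and Cors. 59–60 assume `n, w ≥ 1`
  (print: `n, w ∈ ℕ`; the `(1,1)`-entry form computes `1` on zero layers).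
* **§6 (Jacobian statements):** Def. 50 = the tree's `jacobianMatrix`
  (`Literature/Algebra/Polynomial/JacobianCriterion.lean`, cited) with the rank-over-`𝔽(X)`
  wrapper `jacobianRank`; **Fact 51** [BMS13] and **Lemma 52** [ASSS16] as NAMED FACTS
  (`ForbesShpilkaVolk2018_fact51`, `…_lemma52`; `trdeg` rendered by the cell's `TrdegLE`), with an
  ERRATUM: FSV print the characteristic
  hypothesis as `char(𝔽) ≥ d^r`; the source criterion (Beecken–Mittmann–Saxena) and the truth
  require `char(𝔽) > d^r` (`𝔽_p`, `X^p`: `d^r = p`, Jacobian `p X^{p-1} = 0`), and the facts are typed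
  in the corrected strict form. STATUS (2026-08-26): Fact 51, Lemma 52, Lemma 53 and Thm. 9's §6
  bullet are now THEOREMS of the tree over EVERY field — `ForbesShpilkaVolk2018_fact51_allFields`
  (`FSV18JacobianCriterionAllChar`: [BMS13] App. A with a proved `y_0`-degree Perron bound),
  `ForbesShpilkaVolk2018_lemma52_allFields`, `ForbesShpilkaVolk2018_lemma53_allFields`,
  `FSV2018_thm9_sparseTrdeg_holds` (`FSV18SparseTrdegAllFields`, via `ASSS16FaithfulHomomorphisms`
  and `FSV18Lemma53Reduction`); the `def`s below are kept as the cell's by-name statements.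

## What is NOT here, and why

* (Appended.) **Lemma 53 / Cor. 54** (§6): the generator
  `𝒢^{BMS}_{r,s} = 𝒢^{RC}_{n,r}(y,t) + 𝒢^{SSSV}_{n,m}(w,z)` is `bmsGenCoeff` (the cell's `rcGenCoeff`
  + the tree's `svGenCoeff` on disjoint seeds); its `ΣΠΣ`-succinctness is PROVED
  (`isSuccinctGenerator_bmsGenCoeff`, into the cell's `roProductSums`); the hitting half is the
  NAMED FACT `ForbesShpilkaVolk2018_lemma53` over the cell's `sparseTrdegClass` (strict
  characteristic form); Cor. 54 `ForbesShpilkaVolk2018_cor54` follows, and from it Thm. 9's §6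
  bullet in the strict form with exponent `2r + 2` (`FSV2018_thm9_sparseTrdeg_strict_of_lemma53`),
  which is the cell's `FSV2018_thm9_sparseTrdeg` (revised to the strict form, see the erratum
  above): `FSV2018_thm9_sparseTrdeg_of_lemma53`.
* **§8 Discussion and Open Problems** (p0025; ToC p. 34–35) — open problems are not Literature
  declarations; the ones that are mathematical statements, rendered in this vocabulary:
  (i) "construct succinct hitting sets for stronger models for which we know how to construct
  hitting sets efficiently", in particular a FULLY succinct (poly`log w`) generator for general
  roABPs in ANY order — `∃` a `polylog(w)`-size class `𝒞` with
  `IsSuccinctHittingSet (multilinearMonomials n) 𝒞 {D | ∃ π, IsROABP F w d π D}` (Lemma 55 – Cor. 60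
  give width `w²` and monomial-compatible orders only); (ii) succinct emulation of the
  Klivans–Spielman generator / succinct hitting sets for roABPs in unknown order [AGKS15] and for
  bounded-depth multilinear formulas [OSV16]; (iii) "a circuit class `𝒞` where there are `𝒞`-succinct
  hitting sets for read-once determinants" — the read-once-determinant distinguishers of Nisan /
  Raz / Raz–Yehudayoff; for `𝒞 = VP` this is the route item
  `Summit.ValiantsHypothesis.ValiantsHypothesis.Theses.BarrierLever.ReadOnceDeterminantsHitByVP`
  (stmt-20152, with stmt-20239 `ChowHitsReadOnceDeterminants`) — CITED, not restated;
  (iv) evidence for the Aaronson–Drucker determinant-based pseudorandom candidate (not a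
  mathematical statement as printed). FSV Question 6 itself is `SuccinctHittingSetsForVP`
  (`AlgebraicNaturalProofs.lean`).
* The existence of admissible parameters (`ω` of multiplicative order `≥ (N d w²)²`, `w²` distinct
  `β`'s) is kept as hypotheses, as in print; Cor. 60's bare "there exists" follows in any field
  large enough to contain them.

## References

* [ForbesShpilkaVolk2018] M. A. Forbes, A. Shpilka, B. L. Volk, Theory Comput. 14(18) (2018) 1–45
  (arXiv:1701.05328): §5.3 (roABPs), Def. 50, Fact 51, Lemma 52, Lemma 53, Cor. 54 (= ToC 6.1–6.5),
  Lemma 55, Def. 56, Claims 57–58, Cor. 59, §7.1, Cor. 60 (= ToC 7.1–7.6), §8.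
* [FS13] M. A. Forbes, A. Shpilka, *Quasipolynomial-time identity testing of non-commutative and
  read-once oblivious algebraic branching programs*, FOCS 2013, Construction 3.13, Lemma 3.18 (the
  source of Lemma 55; cited through FSV).
* [BMS13] M. Beecken, J. Mittmann, N. Saxena, *Algebraic independence and blackbox identity
  testing*, Inf. Comput. 222 (2013) (the Jacobian criterion, source of Fact 51; cited through FSV).
* [ASSS16] M. Agrawal, C. Saha, R. Saptharishi, N. Saxena, SIAM J. Comput. 45 (2016) (faithful
  homomorphisms, source of Lemma 52; cited through FSV).
-/

noncomputable section

namespace Literature.Computability.AlgebraicComplexity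

open MvPolynomial Finset Matrix Literature.Barriers.ValiantsHypothesis

/-! ### roABPs (FSV §5.3): the explicit source/sink matrix-product form, path expansion, renaming,
and the bridge to the cell's `IsROABP` (`FSV18SuccinctGenerators.lean`) -/

section ROABP

variable {F : Type*} [CommRing F] {ι : Type*} {N w : ℕ}

/-- The polynomial computed by a layered program in the matrix form of FSV §5.3 with explicit source
and sink weights: transition matrices `M i ∈ F[X]^{w × w}` of univariate polynomials, layer `i`
reading the variable `e i`, `uᵀ · M_0(x_{e 0}) ⋯ M_{N-1}(x_{e (N-1)}) · v`. The class predicate is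
the cell's `IsROABP F w d π f` (the printed `(1,1)`-entry form, `FSV18SuccinctGenerators.lean`);
this evaluation map is the tool to BUILD its members (`isROABP_roABPEval_single` folds the sink
weights into the last layer: "all vertices in `V_n` are connected to `t` with an edge labeled …",
Claim 58). [cite: ForbesShpilkaVolk2018, §5.3 (definition of roABPs, "Equivalently, …")]
locator: paper:arxiv-1701.05328 chunk p0020.txt (§5.3); ToC 14(18) p. 27 -/
def roABPEval (e : Fin N → ι) (M : Fin N → Matrix (Fin w) (Fin w) (Polynomial F))
    (u v : Fin w → F) : MvPolynomial ι F :=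
  (fun a => (C (u a) : MvPolynomial ι F)) ⬝ᵥ
    ((List.ofFn fun i : Fin N =>
        (M i).map fun p => (Polynomial.aeval (X (e i) : MvPolynomial ι F) p : MvPolynomial ι F)).prod *ᵥ
      fun a => (C (v a) : MvPolynomial ι F))

/-- **Path expansion** of the matrix-product form: `uᵀ (∏_i M_i) v = Σ_{paths p} u_{p 0} ·
∏_i (M_i)_{p i, p (i+1)} · v_{p N}` (paths = sequences of `N + 1` states) — the equivalence of the
two printed descriptions of an roABP, "each `s → t` path in the ABP computes the product of its
edge labels, and the roABP computes the sum over the polynomials computed by all `s → t` paths"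
versus "Equivalently, … `F = (∏_{i=1}^N M_i(X_{σ(i)}))_{1,1}`". [cite: ForbesShpilkaVolk2018, §5.3 (definition of roABPs)]
locator: paper:arxiv-1701.05328 chunk p0020.txt (§5.3); ToC 14(18) p. 27 -/
theorem dotProduct_listProd_mulVec {S : Type*} [CommSemiring S]
    (M : Fin N → Matrix (Fin w) (Fin w) S) (u v : Fin w → S) :
    u ⬝ᵥ ((List.ofFn M).prod *ᵥ v) =
      ∑ p : Fin (N + 1) → Fin w, u (p 0) * (∏ i : Fin N, M i (p i.castSucc) (p i.succ)) *
        v (p (Fin.last N)) := by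
  induction N generalizing u with
  | zero =>
      simp only [List.ofFn_zero, List.prod_nil, Matrix.one_mulVec, univ_eq_empty, prod_empty,
        mul_one, dotProduct]
      rw [← (Equiv.funUnique (Fin 1) (Fin w)).symm.sum_comp]
      rfl
  | succ N ih =>
      rw [List.ofFn_succ, List.prod_cons, ← Matrix.mulVec_mulVec, Matrix.dotProduct_mulVec, ih]
      rw [← (Fin.consEquiv fun _ : Fin (N + 2) => Fin w).sum_comp, Fintype.sum_prod_type]
      simp only [Matrix.vecMul, dotProduct, Finset.sum_mul]
      rw [Finset.sum_comm]
      refine Finset.sum_congr rfl fun a _ => Finset.sum_congr rfl fun q _ => ?_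
      have h0 : (Fin.cons a q : Fin (N + 2) → Fin w) 0 = a := rfl
      have h1 : (Fin.cons a q : Fin (N + 2) → Fin w) (Fin.castSucc 0) = a := rfl
      have h2 : (Fin.cons a q : Fin (N + 2) → Fin w) (Fin.succ 0) = q 0 := rfl
      have hcs : ∀ i : Fin N,
          (Fin.cons a q : Fin (N + 2) → Fin w) i.succ.castSucc = q i.castSucc := by
        intro i
        rw [← Fin.succ_castSucc, Fin.cons_succ]
      have hss : ∀ i : Fin N, (Fin.cons a q : Fin (N + 2) → Fin w) i.succ.succ = q i.succ :=
        fun i => Fin.cons_succ _ _ _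
      have hl : (Fin.cons a q : Fin (N + 2) → Fin w) (Fin.last (N + 1)) = q (Fin.last N) := by
        rw [← Fin.succ_last, Fin.cons_succ]
      simp only [Fin.consEquiv, Equiv.coe_fn_mk]
      rw [Fin.prod_univ_succ]
      simp only [h0, h1, h2, hcs, hss, hl]
      ring

/-- The source/sink form expanded along paths, with the substituted entries.
[cite: ForbesShpilkaVolk2018, §5.3 (definition of roABPs)] locator: paper:arxiv-1701.05328 chunk p0020.txt (§5.3) -/
theorem roABPEval_eq_sum (e : Fin N → ι) (M : Fin N → Matrix (Fin w) (Fin w) (Polynomial F))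
    (u v : Fin w → F) :
    roABPEval e M u v =
      ∑ p : Fin (N + 1) → Fin w, C (u (p 0)) *
        (∏ i : Fin N, Polynomial.aeval (X (e i) : MvPolynomial ι F) (M i (p i.castSucc) (p i.succ))) *
          C (v (p (Fin.last N))) := by
  unfold roABPEval
  rw [dotProduct_listProd_mulVec]
  simp only [Matrix.map_apply]

/-- Entrywise maps by a ring homomorphism commute with ordered products of matrices. [folklore] -/
private theorem listProd_map {R S : Type*} [Semiring R] [Semiring S] (f : R →+* S)
    (L : List (Matrix (Fin w) (Fin w) R)) : (L.map fun A => A.map f).prod = L.prod.map f := by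
  induction L with
  | nil => rw [List.map_nil, List.prod_nil, List.prod_nil, Matrix.map_one f (map_zero f) (map_one f)]
  | cons A L ih => rw [List.map_cons, List.prod_cons, List.prod_cons, ih, Matrix.map_mul]

/-- An roABP in the order `π`, after the variable renaming `g`, is an roABP of the same width and
degree in the order `g ∘ π` ("we can apply a permutation `σ` to the variables … to obtain a roABP
in the variables `x` in the order `σ`", §7.1). [cite: ForbesShpilkaVolk2018, §7.1]
locator: paper:arxiv-1701.05328 chunk p0024.txt:L1; ToC 14(18) p. 34 -/
theorem IsROABP.rename {κ : Type*} {d : ℕ} {π : Fin N ≃ ι} {f : MvPolynomial ι F}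
    (h : IsROABP F w d π f) (g : ι ≃ κ) :
    IsROABP F w d (π.trans g) (MvPolynomial.rename g f) := by
  obtain ⟨hw, M, hM, hf⟩ := h
  refine ⟨hw, fun i => (M i).map
    ((MvPolynomial.rename g : MvPolynomial ι F →ₐ[F] MvPolynomial κ F) :
      MvPolynomial ι F →+* MvPolynomial κ F), ?_, ?_⟩
  · intro i a b
    obtain ⟨p, hp, hpe⟩ := hM i a b
    refine ⟨p, hp, ?_⟩
    show ((M i).map _) a b = _
    rw [Matrix.map_apply, hpe, RingHom.coe_coe, ← Polynomial.aeval_algHom_apply, rename_X]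
    rfl
  · have hL : (List.ofFn fun i => (M i).map
        ((MvPolynomial.rename g : MvPolynomial ι F →ₐ[F] MvPolynomial κ F) :
          MvPolynomial ι F →+* MvPolynomial κ F)) =
        (List.ofFn M).map fun A => A.map
          ((MvPolynomial.rename g : MvPolynomial ι F →ₐ[F] MvPolynomial κ F) :
            MvPolynomial ι F →+* MvPolynomial κ F) := by
      rw [List.map_ofFn]
      rfl
    rw [hf, hL, listProd_map, Matrix.map_apply, RingHom.coe_coe]

/-- **From the source/sink form to the printed `(1,1)`-entry form** (Claim 58's last step, "all
vertices in `V_n` are connected to `t` with an edge labeled [a constant]"): for `N ≥ 1` layers,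
source `e_1` and arbitrary sink weights `v`, the polynomial `e_1ᵀ ∏_i M_i(x_{π i}) v` is computed by
a width-`w` roABP in the order `π` of the same individual degree — fold `v` into the last layer.
[cite: ForbesShpilkaVolk2018, Claim 58, proof (seq.; = arXiv v2 Claim 7.6, ToC Claim 7.4)] locator: paper:arxiv-1701.05328 chunk p0023.txt:L79–86; ToC 14(18) Claim 7.4 p. 33 -/
theorem isROABP_roABPEval_single {d : ℕ} (hw : 0 < w) (hN : 0 < N) (π : Fin N ≃ ι)
    (M : Fin N → Matrix (Fin w) (Fin w) (Polynomial F)) (hdeg : ∀ i a b, (M i a b).natDegree ≤ d)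
    (v : Fin w → F) :
    IsROABP F w d π (roABPEval π M (Pi.single ⟨0, hw⟩ 1) v) := by
  classical
  obtain ⟨N', rfl⟩ : ∃ N', N = N' + 1 := ⟨N - 1, by omega⟩
  -- the folded last layer: every state goes to the sink state `0` with the `v`-weighted labels
  let Mf : Fin (N' + 1) → Matrix (Fin w) (Fin w) (Polynomial F) := fun i =>
    if i = Fin.last N' then
      Matrix.of fun r c => if c = ⟨0, hw⟩ then ∑ b, M i r b * Polynomial.C (v b) else 0
    else M i
  let φ : Fin (N' + 1) → Polynomial F → MvPolynomial ι F := fun i p =>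
    Polynomial.aeval (X (π i) : MvPolynomial ι F) p
  have hinit : ∀ i : Fin N', Mf i.castSucc = M i.castSucc := fun i => by
    simp only [Mf, if_neg (Fin.castSucc_lt_last i).ne]
  refine ⟨hw, fun i => (Mf i).map (φ i), ?_, ?_⟩
  · intro i a b
    refine ⟨Mf i a b, ?_, rfl⟩
    by_cases hi : i = Fin.last N'
    · simp only [Mf, hi, if_true, Matrix.of_apply]
      split_ifs
      · exact Polynomial.natDegree_sum_le_of_forall_le _ _ fun b _ =>
          (Polynomial.natDegree_mul_C_le _ _).trans (hdeg _ _ _)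
      · simp
    · simp only [Mf, hi, if_false]
      exact hdeg i a b
  · -- split both ordered products before the last layer
    have hsplit : ∀ A : Fin (N' + 1) → Matrix (Fin w) (Fin w) (MvPolynomial ι F),
        (List.ofFn A).prod = (List.ofFn fun i : Fin N' => A i.castSucc).prod * A (Fin.last N') := by
      intro A
      rw [List.ofFn_succ', List.concat_eq_append, List.prod_append, List.prod_singleton]
    unfold roABPEval
    rw [hsplit, hsplit (fun i => (Mf i).map (φ i)), Matrix.mul_apply]
    have hinit' : (List.ofFn fun i : Fin N' => (Mf i.castSucc).map (φ i.castSucc)) =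
        List.ofFn fun i : Fin N' => (M i.castSucc).map (φ i.castSucc) := by
      simp_rw [hinit]
    rw [hinit']
    set P := (List.ofFn fun i : Fin N' => (M i.castSucc).map (φ i.castSucc)).prod with hP
    -- left: Σ_a C(e_0 a) · ((P * M_last) *ᵥ Cv) a = ((P * M_last) *ᵥ Cv) 0
    simp only [dotProduct]
    rw [Finset.sum_eq_single ⟨0, hw⟩ (fun a _ ha => by rw [Pi.single_eq_of_ne ha, map_zero, zero_mul])
      (fun h => absurd (Finset.mem_univ _) h), Pi.single_eq_same, map_one, one_mul]
    simp only [Matrix.mulVec, dotProduct, Matrix.mul_apply, Matrix.map_apply, Mf, if_true,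
      Matrix.of_apply, φ, map_sum, map_mul, Polynomial.aeval_C, MvPolynomial.algebraMap_eq,
      Finset.sum_mul]
    rw [Finset.sum_comm]
    refine Finset.sum_congr rfl fun r _ => ?_
    rw [Finset.mul_sum]
    exact Finset.sum_congr rfl fun _ _ => mul_assoc _ _ _

end ROABP

/-! ### The binary enumeration of the multilinear monomials (`N = 2ⁿ` coordinates) and the
monomial-compatible orderings of §7.1 -/

section Orders

variable {n : ℕ}

/-- Multilinear exponent vectors `↔` bit vectors `b ∈ {0,1}ⁿ` ("associating `b` with a subset of
`[n]`", §7). [cite: ForbesShpilkaVolk2018, §7 (before Def. 56 seq. = arXiv v2 Def. 7.3, ToC Def. 7.2)]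
locator: paper:arxiv-1701.05328 chunk p0023.txt:L27; ToC 14(18) p. 32 -/
def multilinearEquivBits (n : ℕ) : multilinearMonomials n ≃ (Fin n → Fin 2) where
  toFun m := fun i => ⟨(m : Fin n →₀ ℕ) i,
    Nat.lt_succ_of_le ((show ∀ i, (m : Fin n →₀ ℕ) i ≤ 1 from m.2) i)⟩
  invFun g := ⟨Finsupp.equivFunOnFinite.symm fun i => (g i : ℕ), fun i => by
    rw [Finsupp.coe_equivFunOnFinite_symm]
    exact Nat.le_of_lt_succ (g i).2⟩
  left_inv m := by
    apply Subtype.ext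
    ext i
    simp
  right_inv g := by
    funext i
    apply Fin.ext
    simp

/-- **The variable order `X_1, X_2, …, X_N` of §7** (`N = 2ⁿ`): the `j`-th variable is `X_b` with
`j = Σ_i b_i 2^i` ("the canonical identification of a multilinear monomial with an index in `[N]`,
say, using the binary representation", §7.1; the exponent `2^{i-1}` of Lemma 55 is this weight of
bit `i`). [cite: ForbesShpilkaVolk2018, §7 and §7.1]
locator: paper:arxiv-1701.05328 chunk p0024.txt:L1; ToC 14(18) p. 33 -/
def binaryOrder (n : ℕ) : Fin (2 ^ n) ≃ multilinearMonomials n :=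
  finFunctionFinEquiv.symm.trans (multilinearEquivBits n).symm

/-- **Monomial-compatible orderings** (§7.1): the order on the `N = 2ⁿ` coordinates obtained from
the binary one after permuting the small variables `x_1, …, x_n` by `σ` ("there are merely `n!`
such orderings among the `N!` total orderings on `[N]`"). [cite: ForbesShpilkaVolk2018, §7.1]
locator: paper:arxiv-1701.05328 chunk p0024.txt:L1; ToC 14(18) p. 33 -/
def monomialCompatibleOrder (σ : Equiv.Perm (Fin n)) : Fin (2 ^ n) ≃ multilinearMonomials n :=
  finFunctionFinEquiv.symm.trans
    ((Equiv.arrowCongr σ (Equiv.refl (Fin 2))).trans (multilinearEquivBits n).symm)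

/-- The identity permutation gives the binary order. [cite: ForbesShpilkaVolk2018, §7.1] -/
theorem monomialCompatibleOrder_one :
    monomialCompatibleOrder (1 : Equiv.Perm (Fin n)) = binaryOrder n :=
  Equiv.ext fun _ => rfl

/-- Permuting the small variables `x_1, …, x_n` by `σ` acts on the multilinear monomials
(`x_T ↦ x_{σ(T)}`, exponent vector `m ↦ m ∘ σ⁻¹`). [cite: ForbesShpilkaVolk2018, §7.1]
locator: paper:arxiv-1701.05328 chunk p0024.txt:L1 -/
def permMonomials (σ : Equiv.Perm (Fin n)) : multilinearMonomials n ≃ multilinearMonomials n where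
  toFun m := ⟨Finsupp.equivMapDomain σ (m : Fin n →₀ ℕ), fun i => by
    rw [Finsupp.equivMapDomain_apply]
    exact (show ∀ i, (m : Fin n →₀ ℕ) i ≤ 1 from m.2) _⟩
  invFun m := ⟨Finsupp.equivMapDomain σ.symm (m : Fin n →₀ ℕ), fun i => by
    rw [Finsupp.equivMapDomain_apply]
    exact (show ∀ i, (m : Fin n →₀ ℕ) i ≤ 1 from m.2) _⟩
  left_inv m := by
    apply Subtype.ext
    ext i
    simp [Finsupp.equivMapDomain_apply]
  right_inv m := by
    apply Subtype.ext
    ext i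
    simp [Finsupp.equivMapDomain_apply]

/-- The monomial-compatible order of `σ` is the binary order followed by the action of `σ` on the
monomials. [cite: ForbesShpilkaVolk2018, §7.1] locator: paper:arxiv-1701.05328 chunk p0024.txt:L1 -/
theorem monomialCompatibleOrder_eq_trans (σ : Equiv.Perm (Fin n)) :
    monomialCompatibleOrder σ = (binaryOrder n).trans (permMonomials σ) :=
  Equiv.ext fun j => Subtype.ext (Finsupp.ext fun i => by
    simp [monomialCompatibleOrder, binaryOrder, permMonomials, multilinearEquivBits,
      Equiv.arrowCongr, Finsupp.equivMapDomain_apply])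

end Orders

/-! ### §7: the Forbes–Shpilka generator and its succinct form (Lemma 55, Def. 56, Claims 57–58) -/

section ForbesShpilka

variable {F : Type*} [Field F] {n w : ℕ}

/-- The univariate polynomials `p_ℓ` of Lemma 55 with the convention `p_{ℓ_0}(t) = t`: `none ↦ t`,
`some ℓ ↦` the Lagrange interpolation polynomial with `p_ℓ(β_j) = [ℓ = j]` for the nodes
`β_1, …, β_{w²}`. [cite: ForbesShpilkaVolk2018, Lemma 55 (seq.; = arXiv v2 / ToC Lemma 7.1)]
locator: paper:arxiv-1701.05328 chunk p0023.txt:L13,L25; ToC 14(18) Lemma 7.1 p. 32 -/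
def fsBasis (β : Fin (w ^ 2) → F) : Option (Fin (w ^ 2)) → Polynomial F
  | none => Polynomial.X
  | some ℓ => Lagrange.basis Finset.univ β ℓ

/-- The index sequence `(ℓ_0, ℓ_1, …, ℓ_n)` of a summand of (7.1), `ℓ_0 := none` (so that
`p_{ℓ_0} = id`). [cite: ForbesShpilkaVolk2018, Lemma 55 (seq.; = arXiv v2 / ToC Lemma 7.1)] locator: paper:arxiv-1701.05328 chunk p0023.txt:L19–25 -/
def fsIdx (ℓ : Fin n → Fin (w ^ 2)) : Fin (n + 1) → Option (Fin (w ^ 2)) :=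
  Fin.cons none fun i => some (ℓ i)

/-- The argument `ω^{ℓ_i} y_i` of (7.1) as a polynomial in the seed variables `y_1, …, y_{n+1}`
(indexed by `Fin (n + 1)`; `ℓ_i ∈ [w²] = {1, …, w²}` is `(ℓ i : ℕ) + 1`).
[cite: ForbesShpilkaVolk2018, Lemma 55 (seq.; = arXiv v2 / ToC Lemma 7.1)] locator: paper:arxiv-1701.05328 chunk p0023.txt:L21 -/
def fsArg (ω : F) (ℓ : Fin n → Fin (w ^ 2)) (i : Fin n) : MvPolynomial (Fin (n + 1)) F :=
  C (ω ^ ((ℓ i : ℕ) + 1)) * X i.castSucc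

/-- **Lemma 55 — the Forbes–Shpilka generator `𝒢^{FS}` for roABPs (Construction 3.13 of [FS13]) as
a polynomial map**, coordinate `b ∈ {0,1}ⁿ` (= multilinear exponent vector `m`, `b_i = m_i`):
`𝒢^{FS}_b(y) = Σ_{ℓ_1..ℓ_n ∈ [w²]} ∏_{i ∈ [n]} ((1 - b_i) p_{ℓ_{i-1}}(ω^{ℓ_i} y_i) +
b_i p_{ℓ_{i-1}}((ω^{ℓ_i} y_i)^{2^{i-1} d w²})) · p_{ℓ_n}(y_{n+1})`, `p_{ℓ_0}(t) = t`; here `i` runs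
over `Fin n` (print's `i - 1`), so the exponent is `2^i d w²`, and the `{0,1}`-weighted sum is
written as `if b_i = 0 then … else …`. Parameters: `ω ∈ F`, nodes `β : Fin (w²) → F`, degree `d`.
[cite: ForbesShpilkaVolk2018, Lemma 55, eq. (7.1) (seq.; = arXiv v2 / ToC Lemma 7.1, eq. (7.1))]
locator: paper:arxiv-1701.05328 chunk p0023.txt:L9–25; ToC 14(18) Lemma 7.1 p. 32 -/
def fsGenCoord (n w d : ℕ) (ω : F) (β : Fin (w ^ 2) → F) (m : multilinearMonomials n) :
    MvPolynomial (Fin (n + 1)) F :=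
  ∑ ℓ : Fin n → Fin (w ^ 2),
    (∏ i : Fin n,
      (if (m : Fin n →₀ ℕ) i = 0 then
        Polynomial.aeval (fsArg ω ℓ i) (fsBasis β (fsIdx ℓ i.castSucc))
       else
        Polynomial.aeval (fsArg ω ℓ i ^ (2 ^ (i : ℕ) * d * w ^ 2))
          (fsBasis β (fsIdx ℓ i.castSucc)))) *
      Polynomial.aeval (X (Fin.last n)) (fsBasis β (fsIdx ℓ (Fin.last n)))

/-- **Def. 56 (Succinct Forbes–Shpilka Generator) at a seed `y = α`:**
`P^{FS}(x, α) = Σ_{ℓ_1..ℓ_n ∈ [w²]} ∏_{i ∈ [n]} (p_{ℓ_{i-1}}(ω^{ℓ_i} α_i) +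
x_i · p_{ℓ_{i-1}}((ω^{ℓ_i} α_i)^{2^{i-1} d w²})) · p_{ℓ_n}(α_{n+1})`, a polynomial in `x_1, …, x_n`
(print's `P^{FS}(x, y)` in both sets of variables is this family of polynomials over all `α`).
[cite: ForbesShpilkaVolk2018, Def. 56 (seq.; = arXiv v2 Def. 7.3, ToC Def. 7.2)]
locator: paper:arxiv-1701.05328 chunk p0023.txt:L29–39; ToC 14(18) Def. 7.2 p. 32 -/
def fsPoly (n w d : ℕ) (ω : F) (β : Fin (w ^ 2) → F) (α : Fin (n + 1) → F) :
    MvPolynomial (Fin n) F :=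
  ∑ ℓ : Fin n → Fin (w ^ 2),
    (∏ i : Fin n,
      (C ((fsBasis β (fsIdx ℓ i.castSucc)).eval (ω ^ ((ℓ i : ℕ) + 1) * α i.castSucc)) +
        X i * C ((fsBasis β (fsIdx ℓ i.castSucc)).eval
          ((ω ^ ((ℓ i : ℕ) + 1) * α i.castSucc) ^ (2 ^ (i : ℕ) * d * w ^ 2))))) *
      C ((fsBasis β (fsIdx ℓ (Fin.last n))).eval (α (Fin.last n)))

/-- Evaluating a univariate polynomial substituted into a multivariate one. [folklore] -/
private theorem eval_polynomial_aeval {σ : Type*} (α : σ → F) (q : MvPolynomial σ F)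
    (p : Polynomial F) : eval α (Polynomial.aeval q p) = p.eval (eval α q) := by
  rw [Polynomial.aeval_eq_sum_range, Polynomial.eval_eq_sum_range, map_sum]
  refine Finset.sum_congr rfl fun k _ => ?_
  rw [smul_eval, map_pow]

/-- Coefficients of `p · C a`. [folklore] -/
private theorem coeff_mul_C' {σ : Type*} (m : σ →₀ ℕ) (p : MvPolynomial σ F) (a : F) :
    coeff m (p * C a) = coeff m p * a := by
  rw [mul_comm, coeff_C_mul, mul_comm]

/-- **Claim 57 — `coeff_x(P^{FS}) = 𝒢^{FS}`, PROVED:** the coefficient of the multilinear monomial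
`x_b` in `P^{FS}(x, α)` is `𝒢^{FS}_b(α)`, and `P^{FS}(x, α)` is multilinear ("since the product is
over distinct variables, there is exactly one way to obtain the monomial `x_b`").
[cite: ForbesShpilkaVolk2018, Claim 57 (seq.; = arXiv v2 Claim 7.4, ToC Claim 7.3)]
locator: paper:arxiv-1701.05328 chunk p0023.txt:L43–71; ToC 14(18) Claim 7.3 p. 32 -/
theorem coeff_fsPoly (n w d : ℕ) (ω : F) (β : Fin (w ^ 2) → F) (α : Fin (n + 1) → F)
    (m : Fin n →₀ ℕ) :
    coeff m (fsPoly n w d ω β α) =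
      if hm : m ∈ multilinearMonomials n then eval α (fsGenCoord n w d ω β ⟨m, hm⟩) else 0 := by
  classical
  unfold fsPoly
  rw [coeff_sum]
  have hfac : ∀ ℓ : Fin n → Fin (w ^ 2),
      (∏ i : Fin n,
        (C ((fsBasis β (fsIdx ℓ i.castSucc)).eval (ω ^ ((ℓ i : ℕ) + 1) * α i.castSucc)) +
          X i * C ((fsBasis β (fsIdx ℓ i.castSucc)).eval
            ((ω ^ ((ℓ i : ℕ) + 1) * α i.castSucc) ^ (2 ^ (i : ℕ) * d * w ^ 2))))) =
      ∏ i : Fin n, (C ((fsBasis β (fsIdx ℓ i.castSucc)).eval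
            ((ω ^ ((ℓ i : ℕ) + 1) * α i.castSucc) ^ (2 ^ (i : ℕ) * d * w ^ 2))) * X i +
          C ((fsBasis β (fsIdx ℓ i.castSucc)).eval (ω ^ ((ℓ i : ℕ) + 1) * α i.castSucc))) :=
    fun ℓ => Finset.prod_congr rfl fun i _ => by ring
  simp_rw [coeff_mul_C', hfac, coeff_prod_C_mul_X_add_C]
  split_ifs with hm
  · unfold fsGenCoord
    rw [map_sum]
    refine Finset.sum_congr rfl fun ℓ _ => ?_
    rw [map_mul, map_prod, eval_polynomial_aeval, eval_X]
    congr 1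
    simp_rw [apply_ite (eval α), eval_polynomial_aeval, map_pow]
    rw [Finset.prod_ite]
    have hs : Finset.univ.filter (fun i : Fin n => ¬ (m i = 0)) = m.support := by
      ext i; simp [Finsupp.mem_support_iff]
    have hsc : Finset.univ.filter (fun i : Fin n => m i = 0) = m.supportᶜ := by
      ext i; simp [Finsupp.mem_support_iff]
    rw [hs, hsc, mul_comm]
    have harg : ∀ i : Fin n, eval α (fsArg ω ℓ i) = ω ^ ((ℓ i : ℕ) + 1) * α i.castSucc := by
      intro i; simp [fsArg]
    simp_rw [harg]
  · simp

/-- Claim 57 in the catalogue's vocabulary: the coefficient vector of `P^{FS}(x, α)` on the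
multilinear monomials is the output of the generator `𝒢^{FS}` at the seed `α`.
[cite: ForbesShpilkaVolk2018, Claim 57 (seq.; = arXiv v2 Claim 7.4, ToC Claim 7.3)] locator: paper:arxiv-1701.05328 chunk p0023.txt:L43–46 -/
theorem coeffVector_fsPoly (n w d : ℕ) (ω : F) (β : Fin (w ^ 2) → F) (α : Fin (n + 1) → F) :
    coeffVector (multilinearMonomials n) (fsPoly n w d ω β α) = genOutput (fsGenCoord n w d ω β) α := by
  funext m
  rw [coeffVector_apply, genOutput_apply, coeff_fsPoly, dif_pos m.2]

/-! #### Claim 58: `P^{FS}(x, α)` is a width-`w²` roABP in the order `x_1, …, x_n` -/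

/-- The basis index used by layer `i` from state `r`: `p_{ℓ_0} = id` in the first layer, `p_r`
afterwards. [cite: ForbesShpilkaVolk2018, Claim 58 (seq.; = arXiv v2 Claim 7.6, ToC Claim 7.4)] locator: paper:arxiv-1701.05328 chunk p0023.txt:L81–84 -/
def fsPrev (i : Fin n) (r : Fin (w ^ 2)) : Option (Fin (w ^ 2)) :=
  if (i : ℕ) = 0 then none else some r

/-- The sink index: `ℓ_n` (`none`, i.e. `p_{ℓ_0} = id`, when `n = 0`). [cite: ForbesShpilkaVolk2018, Claim 58 (seq.; = arXiv v2 Claim 7.6, ToC Claim 7.4)]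
locator: paper:arxiv-1701.05328 chunk p0023.txt:L85 -/
def fsLastIdx (n : ℕ) (c : Fin (w ^ 2)) : Option (Fin (w ^ 2)) :=
  if n = 0 then none else some c

/-- **Claim 58's transition matrices**: layer `i` (reading `x_i`) carries, on the edge from state
`r = ℓ_{i-1}` to state `c = ℓ_i`, the linear function
`p_{ℓ_{i-1}}(ω^{ℓ_i} α_i) + x_i · p_{ℓ_{i-1}}((ω^{ℓ_i} α_i)^{2^{i-1} d w²})` (states `[w²]`).
[cite: ForbesShpilkaVolk2018, Claim 58 (seq.; = arXiv v2 Claim 7.6, ToC Claim 7.4)] locator: paper:arxiv-1701.05328 chunk p0023.txt:L79–85; ToC 14(18) Claim 7.4 p. 33 -/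
def fsMatrix (n w d : ℕ) (ω : F) (β : Fin (w ^ 2) → F) (α : Fin (n + 1) → F) (i : Fin n) :
    Matrix (Fin (w ^ 2)) (Fin (w ^ 2)) (Polynomial F) :=
  Matrix.of fun r c =>
    Polynomial.C ((fsBasis β (fsPrev i r)).eval
        ((ω ^ ((c : ℕ) + 1) * α i.castSucc) ^ (2 ^ (i : ℕ) * d * w ^ 2))) * Polynomial.X +
      Polynomial.C ((fsBasis β (fsPrev i r)).eval (ω ^ ((c : ℕ) + 1) * α i.castSucc))

/-- **Claim 58's sink weights**: "all vertices in `V_n` are connected to `t` with an edge labeled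
`p_{ℓ_n}(α_{n+1})`". [cite: ForbesShpilkaVolk2018, Claim 58 (seq.; = arXiv v2 Claim 7.6, ToC Claim 7.4)] locator: paper:arxiv-1701.05328 chunk p0023.txt:L85 -/
def fsSink (n w : ℕ) (β : Fin (w ^ 2) → F) (α : Fin (n + 1) → F) (c : Fin (w ^ 2)) : F :=
  (fsBasis β (fsLastIdx n c)).eval (α (Fin.last n))

/-- Index bookkeeping: along the path `(0, ℓ_1, …, ℓ_n)` the layer-`i` basis index is `ℓ_{i-1}`
(`none` for `i = 0`). [cite: ForbesShpilkaVolk2018, Claim 58 (seq.; = arXiv v2 Claim 7.6, ToC Claim 7.4)] locator: paper:arxiv-1701.05328 chunk p0023.txt:L81 -/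
theorem fsIdx_castSucc (z : Fin (w ^ 2)) (ℓ : Fin n → Fin (w ^ 2)) (i : Fin n) :
    fsIdx ℓ i.castSucc = fsPrev i ((Fin.cons z ℓ : Fin (n + 1) → Fin (w ^ 2)) i.castSucc) := by
  unfold fsIdx fsPrev
  by_cases h : (i : ℕ) = 0
  · have hi : i.castSucc = 0 := Fin.ext (by simp [h])
    rw [hi, if_pos h]
    rfl
  · obtain ⟨k, hk⟩ := Nat.exists_eq_succ_of_ne_zero h
    have hkn : k < n := by have := i.2; omega
    have hi : i.castSucc = (⟨k, hkn⟩ : Fin n).succ := Fin.ext (by simp [hk])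
    rw [hi, if_neg h, Fin.cons_succ, Fin.cons_succ]

/-- Index bookkeeping at the sink: `ℓ_n` is the last state of the path.
[cite: ForbesShpilkaVolk2018, Claim 58 (seq.; = arXiv v2 Claim 7.6, ToC Claim 7.4)] locator: paper:arxiv-1701.05328 chunk p0023.txt:L85 -/
theorem fsIdx_last (z : Fin (w ^ 2)) (ℓ : Fin n → Fin (w ^ 2)) :
    fsIdx ℓ (Fin.last n) = fsLastIdx n ((Fin.cons z ℓ : Fin (n + 1) → Fin (w ^ 2)) (Fin.last n)) := by
  unfold fsIdx fsLastIdx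
  cases n with
  | zero => rfl
  | succ k =>
      rw [← Fin.succ_last, Fin.cons_succ, Fin.cons_succ, if_neg (Nat.succ_ne_zero k)]

/-- **Claim 58's roABP, in source/sink form, computes `P^{FS}(x, α)`:** source `e_1`, transition
matrices `fsMatrix`, sink weights `p_{ℓ_n}(α_{n+1})` (the printed construction, verbatim).
[cite: ForbesShpilkaVolk2018, Claim 58, proof (seq.; = arXiv v2 Claim 7.6, ToC Claim 7.4)]
locator: paper:arxiv-1701.05328 chunk p0023.txt:L79–86; ToC 14(18) Claim 7.4 p. 33 -/
theorem roABPEval_fsMatrix (hw : 0 < w) (d : ℕ) (ω : F) (β : Fin (w ^ 2) → F)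
    (α : Fin (n + 1) → F) :
    roABPEval (Equiv.refl (Fin n)) (fsMatrix n w d ω β α) (Pi.single ⟨0, pow_pos hw 2⟩ 1)
      (fsSink n w β α) = fsPoly n w d ω β α := by
  classical
  have hW : 0 < w ^ 2 := pow_pos hw 2
  unfold roABPEval
  rw [dotProduct_listProd_mulVec,
    ← (Fin.consEquiv fun _ : Fin (n + 1) => Fin (w ^ 2)).sum_comp, Fintype.sum_prod_type]
  simp only [Fin.consEquiv, Equiv.coe_fn_mk, Fin.cons_zero, Fin.cons_succ]
  rw [Finset.sum_eq_single ⟨0, hW⟩]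
  · unfold fsPoly
    refine Finset.sum_congr rfl fun ℓ _ => ?_
    rw [Pi.single_eq_same, map_one, one_mul]
    congr 1
    · refine Finset.prod_congr rfl fun i _ => ?_
      rw [Matrix.map_apply, fsIdx_castSucc ⟨0, hW⟩ ℓ i]
      simp only [fsMatrix, Matrix.of_apply, Equiv.refl_apply, map_add, map_mul,
        Polynomial.aeval_C, Polynomial.aeval_X, MvPolynomial.algebraMap_eq]
      ring
    · rw [fsSink, fsIdx_last ⟨0, hW⟩ ℓ]
  · intro a _ ha
    simp [Pi.single_eq_of_ne ha]
  · intro h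
    exact absurd (Finset.mem_univ _) h

/-- **Claim 58 — PROVED:** for every seed `α`, `P^{FS}(x, α)` is computed by a width-`w²` roABP
of individual degree `1` reading `x_1, x_2, …, x_n` in this order (`n, w ≥ 1`; the class predicate
is the cell's printed `(1,1)`-entry form `IsROABP`, reached from the source/sink form by folding the
sink weights into the last layer, `isROABP_roABPEval_single`). [cite: ForbesShpilkaVolk2018, Claim 58 (seq.; = arXiv v2 Claim 7.6, ToC Claim 7.4)]
locator: paper:arxiv-1701.05328 chunk p0023.txt:L75–86; ToC 14(18) Claim 7.4 p. 33 -/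
theorem isROABP_fsPoly (hw : 0 < w) (hn : 0 < n) (d : ℕ) (ω : F) (β : Fin (w ^ 2) → F)
    (α : Fin (n + 1) → F) :
    IsROABP F (w ^ 2) 1 (Equiv.refl (Fin n)) (fsPoly n w d ω β α) := by
  rw [← roABPEval_fsMatrix hw d ω β α]
  exact isROABP_roABPEval_single (pow_pos hw 2) hn (Equiv.refl (Fin n)) (fsMatrix n w d ω β α)
    (fun i a b => by
      simp only [fsMatrix, Matrix.of_apply]
      exact Polynomial.natDegree_linear_le) (fsSink n w β α)

/-- **Claim 58 with Claim 57: the Forbes–Shpilka generator is width-`w²`-roABP SUCCINCT — PROVED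
(the unconditional half of Cor. 59):** every output `𝒢^{FS}(α)` is the coefficient vector (on the
multilinear monomials) of a polynomial computed by a width-`w²`, individual-degree-`1` roABP in the
order `x_1, …, x_n`. [cite: ForbesShpilkaVolk2018, Claims 57–58 and Cor. 59 (seq.; = arXiv v2 Claims 7.4, 7.6, Cor. 7.7; ToC Claims 7.3, 7.4, Cor. 7.5)]
locator: paper:arxiv-1701.05328 chunk p0023.txt:L88–94; ToC 14(18) Cor. 7.5 p. 33 -/
theorem isSuccinctGenerator_fsGenCoord (hw : 0 < w) (hn : 0 < n) (d : ℕ) (ω : F)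
    (β : Fin (w ^ 2) → F) :
    IsSuccinctGenerator (multilinearMonomials n)
      {f : MvPolynomial (Fin n) F | IsROABP F (w ^ 2) 1 (Equiv.refl (Fin n)) f}
      (fsGenCoord n w d ω β) :=
  fun α => ⟨fsPoly n w d ω β α, isROABP_fsPoly hw hn d ω β α, coeffVector_fsPoly n w d ω β α⟩

/-! #### Lemma 55 (the hitting property, [FS13]) and Corollary 59 -/

/-- **Lemma 55 (Forbes–Shpilka generator for roABPs, Construction 3.13 / Lemma 3.18 ff. of
[FS13]) — NAMED FACT, as printed in FSV:** "Let `n ∈ ℕ` and `N = 2ⁿ`. … Let `ω ∈ 𝔽` be of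
multiplicative order at least `(N d w²)²`, and `β_1, …, β_{w²}` be distinct elements of `𝔽` … the
polynomial map `𝒢^{FS} : 𝔽^{n+1} → 𝔽^N` [eq. (7.1), `fsGenCoord`] is a generator for width `w`,
individual degree `d`, `N`-variate roABPs, in variable order `X_1, X_2, …, X_N`" (the binary order
`binaryOrder n` on the coordinates `c_b`, `b ∈ {0,1}ⁿ`). "Order at least `K`": `ω ≠ 0` and
`ω^k ≠ 1` for `0 < k < K`. Proof in [FS13] (rank concentration), not reproduced in FSV; not
formalised. CAVEAT (provenance, val-lit PRINT-ERRATA B13; lead-np ruling (23)): [FS13]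
Construction 3.13 / Thm. 3.21 prove this for the exponent `2^{i−1}(d+1)w²` and
`ord(ω) ≥ (N(d+1)w²)²` (FS13's strict individual-degree convention `< n`); FSV's `d`-version, typed
here verbatim from FSV, is not literally covered by [FS13] — very likely true (the `w²` factor
plausibly absorbs the `+1`; `w = 1` checked), truth undecided, NOT refuted; any discharge targets
the safe reading `d ↦ d+1` in both places as a sibling `ForbesShpilkaVolk2018_lemma55_safe` and
re-runs Cor. 59/60 and `FSV2018_thm10_of_lemma55` on it. The typed text below is unchanged.
[cite: ForbesShpilkaVolk2018, Lemma 55 (seq.; = arXiv v2 / ToC Lemma 7.1); ForbesShpilka2013, Construction 3.13 / Thm. 3.21 (strict-degree convention)]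
locator: paper:arxiv-1701.05328 chunk p0023.txt:L9–25; ToC 14(18) Lemma 7.1 p. 32; paper:arxiv-1209.2408 p0004.txt:L38 («individual degree < n») -/
def ForbesShpilkaVolk2018_lemma55 (F : Type*) [Field F] : Prop :=
  ∀ (n w d : ℕ) (ω : F) (β : Fin (w ^ 2) → F), Function.Injective β → ω ≠ 0 →
    (∀ k : ℕ, 0 < k → k < (2 ^ n * d * w ^ 2) ^ 2 → ω ^ k ≠ 1) →
      IsHittingSetGenerator
        {D : MvPolynomial (multilinearMonomials n) F | IsROABP F w d (binaryOrder n) D}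
        (fsGenCoord n w d ω β)

/-- **Cor. 59 (from Lemma 55, Claim 57 and Claim 58):** "The Forbes–Shpilka generator given in
Lemma 55 is a width `w²`-roABP succinct generator for degree `d` roABPs that read the variables in
order `X_1, X_2, …, X_N`" — the hitting half is Lemma 55 (taken as the hypothesis `h55`), the
succinctness half is proved (`isSuccinctGenerator_fsGenCoord`). [cite: ForbesShpilkaVolk2018, Cor. 59 (seq.; = arXiv v2 Cor. 7.7, ToC Cor. 7.5)]
locator: paper:arxiv-1701.05328 chunk p0023.txt:L88–94; ToC 14(18) Cor. 7.5 p. 33 -/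
theorem ForbesShpilkaVolk2018_cor59 (h55 : ForbesShpilkaVolk2018_lemma55 F) (hw : 0 < w)
    (hn : 0 < n) (d : ℕ) {ω : F} {β : Fin (w ^ 2) → F} (hβ : Function.Injective β) (hω : ω ≠ 0)
    (hord : ∀ k : ℕ, 0 < k → k < (2 ^ n * d * w ^ 2) ^ 2 → ω ^ k ≠ 1) :
    IsHittingSetGenerator
        {D : MvPolynomial (multilinearMonomials n) F | IsROABP F w d (binaryOrder n) D}
        (fsGenCoord n w d ω β) ∧
      IsSuccinctGenerator (multilinearMonomials n)
        {f : MvPolynomial (Fin n) F | IsROABP F (w ^ 2) 1 (Equiv.refl (Fin n)) f}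
        (fsGenCoord n w d ω β) :=
  ⟨h55 n w d ω β hβ hω hord, isSuccinctGenerator_fsGenCoord hw hn d ω β⟩

/-! #### §7.1 Different variable orderings: Corollary 60 -/

/-- **Cor. 60 (§7.1) — from Lemma 55, PROVED otherwise:** "There exists a width-`w²` roABP
succinct hitting set for the class of width `w`, `N` variate, and degree `d` roABPs that read the
variables in a monomial compatible ordering": over an infinite field (print: "over large enough
fields" generators give hitting sets, remark after Def. 7; "we do not care about the size of the
hitting set"), for admissible `ω, β` as in Lemma 55, the coefficient vectors of the polynomials
computed by width-`w²`, individual-degree-`1`, `n`-variate roABPs (in some order `σ` of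
`x_1, …, x_n` — the permuted `P^{FS}(x_σ, α)`) hit every nonzero `N = 2ⁿ`-variate width-`w`
individual-degree-`d` roABP reading its variables `c_b` in the monomial-compatible ordering of any
`σ` ("take the union of all `n!` those succinct hitting sets"). The hitting property of `𝒢^{FS}`
itself is the hypothesis `h55` (Lemma 55, [FS13]). [cite: ForbesShpilkaVolk2018, Cor. 60 (seq.; = arXiv v2 Cor. 7.8, ToC Cor. 7.6) and §7.1]
locator: paper:arxiv-1701.05328 chunk p0024.txt:L1–6; ToC 14(18) Cor. 7.6 p. 34 -/
theorem ForbesShpilkaVolk2018_cor60 [Infinite F] (h55 : ForbesShpilkaVolk2018_lemma55 F)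
    (hw : 0 < w) (hn : 0 < n) (d : ℕ) {ω : F} {β : Fin (w ^ 2) → F} (hβ : Function.Injective β)
    (hω : ω ≠ 0)
    (hord : ∀ k : ℕ, 0 < k → k < (2 ^ n * d * w ^ 2) ^ 2 → ω ^ k ≠ 1) :
    IsSuccinctHittingSet (multilinearMonomials n)
      {f : MvPolynomial (Fin n) F | ∃ σ : Equiv.Perm (Fin n), IsROABP F (w ^ 2) 1 σ f}
      {D : MvPolynomial (multilinearMonomials n) F |
        ∃ σ : Equiv.Perm (Fin n), IsROABP F w d (monomialCompatibleOrder σ) D} := by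
  rintro D ⟨σ, hD⟩ hD0
  set ψ := (permMonomials σ).symm with hψ
  have hD' : IsROABP F w d (binaryOrder n) (MvPolynomial.rename ψ D) := by
    have h := hD.rename ψ
    rwa [monomialCompatibleOrder_eq_trans, Equiv.trans_assoc, Equiv.self_trans_symm,
      Equiv.trans_refl] at h
  have hD0' : MvPolynomial.rename ψ D ≠ 0 := fun h =>
    hD0 (rename_injective _ ψ.injective (by rw [h, map_zero]))
  obtain ⟨α, hα⟩ := (h55 n w d ω β hβ hω hord).exists_eval_genOutput_ne_zero hD' hD0'
  refine ⟨MvPolynomial.rename σ (fsPoly n w d ω β α), ⟨σ, ?_⟩, ?_⟩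
  · have h := (isROABP_fsPoly (n := n) hw hn d ω β α).rename σ
    rwa [Equiv.refl_trans] at h
  · rw [← coeffVector_fsPoly, eval_rename] at hα
    have hv : coeffVector (multilinearMonomials n) (MvPolynomial.rename σ (fsPoly n w d ω β α)) =
        coeffVector (multilinearMonomials n) (fsPoly n w d ω β α) ∘ ψ := by
      funext m
      simp only [Function.comp_apply, coeffVector_apply]
      have hm : (m : Fin n →₀ ℕ) =
          Finsupp.mapDomain σ ((ψ m : multilinearMonomials n) : Fin n →₀ ℕ) := by
        rw [← Finsupp.equivMapDomain_eq_mapDomain]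
        ext i
        simp [hψ, permMonomials, Finsupp.equivMapDomain_apply]
      rw [hm, coeff_rename_mapDomain _ σ.injective]
    rw [hv]
    exact hα

/-! #### Admissible parameters exist in every infinite field; Cor. 60 hypothesis-free -/

/-- Over an infinite field the parameters of Lemma 55 exist: `w²` distinct nodes `β` and a nonzero
`ω` none of whose powers `ω^k`, `0 < k < K`, is `1` (FSV, remark after Def. 7: hitting sets live
"over large enough fields"; each `X^k - 1` has at most `k` roots). [cite: ForbesShpilkaVolk2018, Lemma 55 (seq.; = arXiv v2 / ToC Lemma 7.1) (parameters) and remark after Def. 7 (seq.; = Def. 1.7)]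
locator: paper:arxiv-1701.05328 chunk p0023.txt:L13; ToC 14(18) Lemma 7.1 p. 32 -/
theorem exists_fsParams [Infinite F] (K w : ℕ) :
    ∃ (ω : F) (β : Fin (w ^ 2) → F), Function.Injective β ∧ ω ≠ 0 ∧
      ∀ k : ℕ, 0 < k → k < K → ω ^ k ≠ 1 := by
  classical
  -- the finitely many bad values of `ω`: `0` and the `k`-th roots of unity, `0 < k < K`
  let bad : Finset F := insert 0 ((Finset.range K).biUnion fun k => Polynomial.nthRootsFinset k (1 : F))
  obtain ⟨ω, hω⟩ := Infinite.exists_notMem_finset bad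
  refine ⟨ω, fun i => Infinite.natEmbedding F i, ?_, ?_, ?_⟩
  · intro i j h
    exact Fin.ext (by simpa using (Infinite.natEmbedding F).injective h)
  · intro h
    exact hω (by simp [bad, h])
  · intro k hk hkK h
    refine hω (Finset.mem_insert_of_mem (Finset.mem_biUnion.2 ⟨k, Finset.mem_range.2 hkK, ?_⟩))
    exact (Polynomial.mem_nthRootsFinset hk (1 : F)).2 h

/-- **Cor. 60 as printed (hypothesis-free existence form over an infinite field):** given the
hitting property of the Forbes–Shpilka generator (Lemma 55, `h55`), for `n, w ≥ 1` and every `d`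
the polynomials computed by width-`w²`, individual-degree-`1`, `n`-variate roABPs (in some order)
are a succinct hitting set for the width-`w`, individual-degree-`d`, `N = 2ⁿ`-variate roABPs reading
their variables in any of the monomial-compatible orderings `monomialCompatibleOrder σ`
("There exists a width-`w²` roABP succinct hitting set for the class of width `w`, `N` variate,
and degree `d` roABPs that read the variables in a monomial compatible ordering").
[cite: ForbesShpilkaVolk2018, Cor. 60 (seq.; = arXiv v2 Cor. 7.8, ToC Cor. 7.6)] locator: paper:arxiv-1701.05328 chunk p0024.txt:L5–6; ToC 14(18) Cor. 7.6 p. 34 -/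
theorem ForbesShpilkaVolk2018_cor60' [Infinite F] (h55 : ForbesShpilkaVolk2018_lemma55 F)
    (hw : 0 < w) (hn : 0 < n) (d : ℕ) :
    IsSuccinctHittingSet (multilinearMonomials n)
      {f : MvPolynomial (Fin n) F | ∃ σ : Equiv.Perm (Fin n), IsROABP F (w ^ 2) 1 σ f}
      {D : MvPolynomial (multilinearMonomials n) F |
        ∃ σ : Equiv.Perm (Fin n), IsROABP F w d (monomialCompatibleOrder σ) D} := by
  obtain ⟨ω, β, hβ, hω, hord⟩ := exists_fsParams (F := F) ((2 ^ n * d * w ^ 2) ^ 2) w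
  exact ForbesShpilkaVolk2018_cor60 h55 hw hn d hβ hω hord

end ForbesShpilka



/-! ### §6: circuits of sparsely small transcendence degree — the Jacobian statements -/

section Jacobian

open Literature.Algebra.Polynomial.JacobianCriterion

/-- **Def. 50 (the Jacobian matrix `Jac_X(F)_{i,j} = ∂F_i/∂X_j`)** is the tree's
`Literature.Algebra.Polynomial.JacobianCriterion.jacobianMatrix` (cited, not re-declared); this
abbreviation records the `m × N` instance over the variables `X_1, …, X_N` and its rank "over
`𝔽(X)`" = after mapping the entries into the fraction field. [cite: ForbesShpilkaVolk2018, Def. 50 (seq.; = arXiv v2 / ToC Def. 6.1)]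
locator: paper:arxiv-1701.05328 chunk p0022.txt:L7–9; ToC 14(18) Def. 6.1 p. 31 -/
def jacobianRank {F : Type*} [Field F] {N m : ℕ} (Fv : Fin m → MvPolynomial (Fin N) F) : ℕ :=
  ((jacobianMatrix Fv).map
    (algebraMap (MvPolynomial (Fin N) F) (FractionRing (MvPolynomial (Fin N) F)))).rank

/-- **Fact 51 ([BMS13], the Jacobian criterion) — NAMED FACT, CORRECTED:** "Let
`F_1, …, F_m ⊆ 𝔽[X]` be `N`-variate polynomials over `𝔽` of degree at most `d`, such that
`trdeg{F_1, …, F_m} = r`. If `char(𝔽) = 0` or `char(𝔽) ≥ d^r` [sic], then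
`rank_{𝔽(X)} Jac_X(F) = r`." ERRATUM (typed in corrected form, as Beecken–Mittmann–Saxena state
it): the positive-characteristic hypothesis must be STRICT, `char(𝔽) > d^r` — with `≥` the
statement is false (`𝔽 = 𝔽_p`, `F_1 = X_1^p`: `d = p`, `r = 1`, `d^r = p = char`, but
`∂F_1/∂X_1 = p X_1^{p-1} = 0` has rank `0`). "`trdeg{F_1, …, F_m} = r`" is rendered with the
cell's `TrdegLE` (§4.2: "the size of a maximal algebraically independent subset"): every
algebraically independent subfamily has `≤ r` members and some has exactly `r`. PROVED for every
field: `ForbesShpilkaVolk2018_fact51_allFields` (`FSV18JacobianCriterionAllChar`; characteristic `0`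
alone: `ForbesShpilkaVolk2018_fact51_of_charZero`).
[cite: ForbesShpilkaVolk2018, Fact 51 (seq.; = arXiv v2 / ToC Fact 6.2)]
locator: paper:arxiv-1701.05328 chunk p0022.txt:L13–15; ToC 14(18) Fact 6.2 p. 31 -/
def ForbesShpilkaVolk2018_fact51 (F : Type*) [Field F] : Prop :=
  ∀ (N m d r : ℕ) (Fv : Fin m → MvPolynomial (Fin N) F),
    (∀ i, (Fv i).totalDegree ≤ d) →
    TrdegLE F Fv r → (∃ S : Finset (Fin m), S.card = r ∧ AlgebraicIndependent F fun i : S => Fv i) →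
    (ringChar F = 0 ∨ d ^ r < ringChar F) →
      jacobianRank Fv = r

/-- **Lemma 52 ([ASSS16], the "faithful homomorphism recipe") — NAMED FACT, as restated in FSV
(with the characteristic hypothesis corrected as in Fact 51):** for `F_1, …, F_m ∈ 𝔽[X_1..X_N]` of
degree `≤ d` with `trdeg ≤ r`, `char(𝔽) = 0` or `char(𝔽) > d^r`, any `C(y_1, …, y_m)`, and any
homomorphism `Φ : 𝔽[X] → 𝔽[z]` preserving the rank of the Jacobian
(`rank_{𝔽(X)} Jac_X(F) = rank_{𝔽(z)} Φ(Jac_X(F))`; `trdeg ≤ r` = the cell's `TrdegLE`), the map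
`Ψ : X_i ↦ (Σ_{j=1}^r s_j t^{ij}) + Φ(X_i)` (fresh variables `s_1, …, s_r, t`; print writes
`Σ_{i=1}^r y_j t^{ij}`, a typo for the sum over `j`) satisfies
`C(F_1, …, F_m) ≢ 0 ↔ C(Ψ(F_1), …, Ψ(F_m)) ≢ 0`. The `z`-variables are `Fin M`, the fresh ones
`Fin r ⊕ Unit`. PROVED for every field: `ForbesShpilkaVolk2018_lemma52_allFields`
(`FSV18SparseTrdegAllFields`; [ASSS16] Lemma 2.2 in `ASSS16FaithfulHomomorphisms`).
[cite: ForbesShpilkaVolk2018, Lemma 52 (seq.; = arXiv v2 / ToC Lemma 6.3)]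
locator: paper:arxiv-1701.05328 chunk p0022.txt:L19–25; ToC 14(18) Lemma 6.3 p. 31 -/
def ForbesShpilkaVolk2018_lemma52 (F : Type*) [Field F] : Prop :=
  ∀ (N m M d r : ℕ) (Fv : Fin m → MvPolynomial (Fin N) F) (Cp : MvPolynomial (Fin m) F)
    (Φ : MvPolynomial (Fin N) F →ₐ[F] MvPolynomial (Fin M) F),
    (∀ i, (Fv i).totalDegree ≤ d) →
    TrdegLE F Fv r →
    (ringChar F = 0 ∨ d ^ r < ringChar F) →
    jacobianRank Fv =
      ((jacobianMatrix Fv).map fun q =>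
        algebraMap (MvPolynomial (Fin M) F) (FractionRing (MvPolynomial (Fin M) F)) (Φ q)).rank →
      (aeval Fv Cp ≠ 0 ↔
        aeval (fun i : Fin m =>
          aeval (fun k : Fin N =>
            (∑ j : Fin r, (X (Sum.inr (Sum.inl j)) : MvPolynomial (Fin M ⊕ (Fin r ⊕ Unit)) F) *
                X (Sum.inr (Sum.inr ())) ^ (((k : ℕ) + 1) * ((j : ℕ) + 1))) +
              rename Sum.inl (Φ (X k))) (Fv i)) Cp ≠ 0)

end Jacobian

/-! ### §6: Lemma 53 / Cor. 54 — the generator `𝒢^{BMS}_{r,s}` for circuits over sparse polynomials of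
small transcendence degree -/

section BMS

variable (F : Type*) [CommRing F] {n : ℕ}

/-- Lemma 53's seed length `m = r log s + r log r` of the shifted SV block (logs rounded up).
[cite: ForbesShpilkaVolk2018, Lemma 53 (seq.; = arXiv v2 / ToC Lemma 6.4)] locator: paper:arxiv-1701.05328 chunk p0022.txt:L31; ToC 14(18) Lemma 6.4 p. 31 -/
def bmsK (r s : ℕ) : ℕ := r * Nat.clog 2 s + r * Nat.clog 2 r

/-- **Lemma 53's generator `𝒢^{BMS}_{r,s}(y, t, w, z) := 𝒢^{RC}_{n,r}(y, t) + 𝒢^{SSSV}_{n,m}(w, z)`**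
(`m = r log s + r log r`), coordinate-wise on disjoint seed blocks: the cell's succinct rank
condenser `rcGenCoeff` (Construction 16) plus the tree's shifted succinct SV generator `svGenCoeff`
(Constructions 25/29). [cite: ForbesShpilkaVolk2018, Lemma 53 (seq.; = arXiv v2 / ToC Lemma 6.4)]
locator: paper:arxiv-1701.05328 chunk p0022.txt:L29–35; ToC 14(18) Lemma 6.4 p. 31 -/
def bmsGenCoeff (n r s : ℕ) (m : Fin n →₀ ℕ) :
    MvPolynomial ((Fin r ⊕ Fin (n + 1)) ⊕ (Fin (bmsK r s) ⊕ (Fin (bmsK r s) × Fin n))) F :=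
  rename Sum.inl (rcGenCoeff F n r m) + rename Sum.inr (svGenCoeff F n (bmsK r s) m)

variable {F}

/-- **Lemma 53, succinctness half ("Furthermore, the generator `𝒢^{BMS}_{r,s}` is
`poly(r, log s, n)`-`ΣΠΣ` succinct") — PROVED:** every output is the coefficient vector of a
read-once affine product sum of top fan-in `r + (r log s + r log r) + 1` (the cell's
`roProductSums`, hence a multilinear `ΣΠΣ` formula of size `poly(r, log s, n)`:
`roProductSums_subset_multilinearSPS`). Print's proof: "(cl:succinct-vdm-is-vdm) and
(fact:sssv-succinct)" = `isSuccinctGenerator_rcGenCoeff` + `isSuccinctGenerator_svGenCoeff`.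
[cite: ForbesShpilkaVolk2018, Lemma 53 (seq.; = arXiv v2 / ToC Lemma 6.4)] locator: paper:arxiv-1701.05328 chunk p0022.txt:L38,L43; ToC 14(18) Lemma 6.4 p. 31 -/
theorem isSuccinctGenerator_bmsGenCoeff (r s : ℕ) :
    IsSuccinctGenerator (multilinearMonomials n) (roProductSums F n (r + (bmsK r s + 1)))
      (fun m : multilinearMonomials n => bmsGenCoeff F n r s (m : Fin n →₀ ℕ)) := by
  intro a
  obtain ⟨f, hf, hfa⟩ :=
    isSuccinctGenerator_rcGenCoeff (F := F) (n := n) r (fun v => a (Sum.inl v))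
  obtain ⟨g, hg, hga⟩ :=
    isSuccinctGenerator_svGenCoeff (F := F) (n := n) (bmsK r s) (fun v => a (Sum.inr v))
  refine ⟨f + g, add_mem_roProductSums hf hg, ?_⟩
  funext m
  have h1 := congr_fun hfa m
  have h2 := congr_fun hga m
  rw [coeffVector_apply, genOutput_apply] at h1 h2
  rw [coeffVector_apply, genOutput_apply, coeff_add, bmsGenCoeff, map_add, eval_rename, eval_rename,
    h1, h2]
  rfl

/-- **Lemma 53, hitting half — NAMED FACT:** "Let `F_1, …, F_m ⊆ 𝔽[X]` be `N`-variate polynomials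
of sparsity at most `s`, such that `trdeg{F_1, …, F_m} ≤ r`. Then for any polynomial of the form
`G(x) = C(F_1, …, F_m)`, we have that `G ≢ 0` if and only if `G ∘ 𝒢^{BMS}_{r,s} ≢ 0`" — a hitting
set generator for the cell's `sparseTrdegClass _ r s d` (the degree bound `d` and the
characteristic hypothesis, `char 𝔽 = 0` or `char 𝔽 > d^r` in the CORRECTED strict form of Fact 51,
are §6's standing assumptions inherited from Lemma 52; `N = 2ⁿ` coordinates). Print's proof:
Lemma 52 + "each `r × r` minor of [the Jacobian] is a polynomial of sparsity at most `r!·s^r`" +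
Cor. 34 — PROVED along that proof: `ForbesShpilkaVolk2018_lemma53_of_lemma52`
(`FSV18Lemma53Reduction`), and for every field `ForbesShpilkaVolk2018_lemma53_allFields`
(`FSV18SparseTrdegAllFields`). [cite: ForbesShpilkaVolk2018, Lemma 53 (seq.; = arXiv v2 / ToC Lemma 6.4)]
locator: paper:arxiv-1701.05328 chunk p0022.txt:L29–41; ToC 14(18) Lemma 6.4 p. 31 -/
def ForbesShpilkaVolk2018_lemma53 (F : Type*) [Field F] : Prop :=
  ∀ (n r s d : ℕ), (ringChar F = 0 ∨ d ^ r < ringChar F) →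
    IsHittingSetGenerator (sparseTrdegClass F (multilinearMonomials n) r s d)
      (fun m : multilinearMonomials n => bmsGenCoeff F n r s (m : Fin n →₀ ℕ))

/-- **Cor. 54 (from Lemma 53):** "There exists a `poly(log s, r, n)`-`ΣΠΣ` succinct generator for the
class of polynomials of the form `C(F_1, …, F_m)` such that each `F_i` has sparsity at most `s` and
`trdeg{F_1, …, F_m} ≤ r`" — with the explicit witness `𝒢^{BMS}_{r,s}` and top fan-in
`r + (r log s + r log r) + 1`; the hitting half is Lemma 53 (hypothesis `h53`), the succinctness
half is proved. [cite: ForbesShpilkaVolk2018, Cor. 54 (seq.; = arXiv v2 / ToC Cor. 6.5)]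
locator: paper:arxiv-1701.05328 chunk p0022.txt:L46–47; ToC 14(18) Cor. 6.5 p. 31 -/
theorem ForbesShpilkaVolk2018_cor54 {F : Type*} [Field F] (h53 : ForbesShpilkaVolk2018_lemma53 F)
    (n r s d : ℕ) (hchar : ringChar F = 0 ∨ d ^ r < ringChar F) :
    ∃ (τ : Type) (_ : Fintype τ) (G : multilinearMonomials n → MvPolynomial τ F),
      IsHittingSetGenerator (sparseTrdegClass F (multilinearMonomials n) r s d) G ∧
        IsSuccinctGenerator (multilinearMonomials n) (roProductSums F n (r + (bmsK r s + 1))) G :=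
  ⟨_, inferInstance, _, h53 n r s d hchar, isSuccinctGenerator_bmsGenCoeff r s⟩

end BMS

/-! ### Thm. 9 (ToC Thm. 1.10), bullet 7 (§6) from Lemma 53 / Cor. 54 -/

section ThmNineSparseTrdeg

/-- Size arithmetic for the §6 bullet of Thm. 9: the top fan-in `r + (r⌈log₂ s⌉ + r⌈log₂ r⌉) + 1`
of `𝒢^{BMS}_{r,s}` (Lemma 53) times the factor `n + 2` of Lemma 14 is at most
`(⌊log₂ s⌋ + n + 2) ^ (2r + 2)` ("`poly(r, log s, n)`-`ΣΠΣ` succinct").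
[cite: ForbesShpilkaVolk2018, Lemma 53 and Thm. 9 (seq.) = ToC Lemma 6.4 and Thm. 1.10]
locator: paper:arxiv-1701.05328 chunk p0022.txt:L38; ToC 14(18) p. 31 -/
theorem bms_topFanIn_mul_le (r s n : ℕ) :
    (r + (bmsK r s + 1)) * (n + 2) ≤ (Nat.log 2 s + n + 2) ^ (2 * r + 2) := by
  have hcs : Nat.clog 2 s ≤ Nat.log 2 s + 1 :=
    (Nat.clog_le_iff_le_pow Nat.one_lt_two).2 (Nat.lt_pow_succ_log_self Nat.one_lt_two s).le
  have hcr : Nat.clog 2 r ≤ r := (Nat.clog_le_iff_le_pow Nat.one_lt_two).2 r.lt_two_pow_self.le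
  have hr : r + 1 ≤ (Nat.log 2 s + n + 2) ^ r :=
    (r.lt_two_pow_self).trans_le (Nat.pow_le_pow_left (by omega) r)
  have h1 : r * Nat.clog 2 s ≤ r * (Nat.log 2 s + n + 2) :=
    Nat.mul_le_mul_left r (hcs.trans (by omega))
  have h2 : r * Nat.clog 2 r ≤ r * r := Nat.mul_le_mul_left r hcr
  have hK : r + (bmsK r s + 1) ≤ (r + 1) * (r + 1) * (Nat.log 2 s + n + 2) := by
    unfold bmsK
    nlinarith [h1, h2, Nat.zero_le r, Nat.zero_le (Nat.log 2 s + n)]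
  calc (r + (bmsK r s + 1)) * (n + 2)
      ≤ ((r + 1) * (r + 1) * (Nat.log 2 s + n + 2)) * (Nat.log 2 s + n + 2) :=
        Nat.mul_le_mul hK (by omega)
    _ ≤ ((Nat.log 2 s + n + 2) ^ r * (Nat.log 2 s + n + 2) ^ r * (Nat.log 2 s + n + 2)) *
          (Nat.log 2 s + n + 2) := by gcongr
    _ = (Nat.log 2 s + n + 2) ^ (2 * r + 2) := by ring

/-- **FSV Thm. 9 (ToC Thm. 1.10), bullet "Arbitrary circuits composed with sparse polynomials of
transcendence degree `O(1)`" (§6), PROVED modulo Lemma 53 (`h53`) in the CORRECTED strict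
characteristic form** (`char 𝔽 = 0` or `char 𝔽 > d^r`; see the erratum in this file's header and
at `ForbesShpilkaVolk2018_fact51`): over every infinite field the multilinear `ΣΠΣ` formulas of size
`(⌊log₂ s⌋ + n + 2)^{2r+2}` are a succinct hitting set for the cell's `sparseTrdegClass _ r s d`
(`C(F_1, …, F_M)`, each `F_i` `s`-sparse of degree `≤ d`, `trdeg ≤ r`). Proof = print's: Cor. 54's
generator `𝒢^{BMS}_{r,s}` (hitting: Lemma 53; `ΣΠΣ`-succinct: `isSuccinctGenerator_bmsGenCoeff`)
fed to Lemma 14 (`multilinearSPSHits_of_generator`). This is the cell's bullet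
`FSV2018_thm9_sparseTrdeg` (`FSV18SuccinctGenerators.lean`, in its revised strict-characteristic
form) with the exponent made explicit; see `FSV2018_thm9_sparseTrdeg_of_lemma53`.
[cite: ForbesShpilkaVolk2018, Thm. 9 bullet 7 and Cor. 54 (seq.) = ToC Thm. 1.10 and Cor. 6.5, pp. 15, 31]
locator: paper:arxiv-1701.05328 chunk p0011.txt:L16, p0022.txt:L46–47; ToC 14(18) p. 15 L8, p. 31 -/
theorem FSV2018_thm9_sparseTrdeg_strict_of_lemma53
    (h53 : ∀ (F : Type) [Field F], ForbesShpilkaVolk2018_lemma53 F) (r : ℕ) :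
    ∃ c : ℕ, ∀ (F : Type) [Field F] [Infinite F] (n s d : ℕ),
      (ringChar F = 0 ∨ d ^ r < ringChar F) →
        MultilinearSPSHits F n ((Nat.log 2 s + n + 2) ^ c)
          (sparseTrdegClass F (multilinearMonomials n) r s d) :=
  ⟨2 * r + 2, fun F _ _ n s d hchar =>
    multilinearSPSHits_of_generator (h53 F n r s d hchar) (isSuccinctGenerator_bmsGenCoeff r s)
      (bms_topFanIn_mul_le r s n)⟩

/-- **FSV Thm. 9 (ToC Thm. 1.10), §6 bullet — the cell's named fact `FSV2018_thm9_sparseTrdeg`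
(seventh conjunct of the LOAD-BEARING `FSV2018_thm9`) PROVED modulo Lemma 53:** immediate from
`FSV2018_thm9_sparseTrdeg_strict_of_lemma53` (the cell's fact carries the corrected strict
characteristic hypothesis, as Lemma 53 does).
[cite: ForbesShpilkaVolk2018, Thm. 9 bullet 7 and Cor. 54 (seq.) = ToC Thm. 1.10 and Cor. 6.5, pp. 15, 31]
locator: paper:arxiv-1701.05328 chunk p0011.txt:L16, p0022.txt:L46–47; ToC 14(18) p. 15 L8, p. 31 -/
theorem FSV2018_thm9_sparseTrdeg_of_lemma53
    (h53 : ∀ (F : Type) [Field F], ForbesShpilkaVolk2018_lemma53 F) : FSV2018_thm9_sparseTrdeg :=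
  fun r => FSV2018_thm9_sparseTrdeg_strict_of_lemma53 h53 r

end ThmNineSparseTrdeg

end Literature.Computability.AlgebraicComplexity

end
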